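import Literature.Geometry.Manifold.InverseFunctionTheorem
import HarnessLib

/-!
# The inverse of an injective map with invertible differential on an open set is smooth

Topic `Geometry/Manifold`.  Consequence of the inverse function theorem for manifolds
(`Literature.Geometry.Manifold.isLocalDiffeomorphAt_of_mfderiv`, Lee 2013, Thm. 4.5) and of
Mathlib's `IsLocalDiffeomorphAt.localInverse` API, in the form needed to treat a COLLAR
`c : N × (-δ, δ) → M` of a hypersurface (injective, with bijective differential on the open band)
as a diffeomorphism onto its open image (step (S3)/(S4) of the unfolding of an origami manifold,
Cannas da Silva–Guillemin–Pires, Prop. 2.8: the gluing map and the blow-down are composites of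
the inverse collar with smooth maps):

* `continuousLinearEquivOfBijective` — a bijective continuous linear map of finite-dimensional
  spaces as an equivalence (bookkeeping);
* `isLocalDiffeomorphAt_of_bijective_mfderiv` — a map `C^∞` on an open set with bijective
  differential at a point of it is a local diffeomorphism there;
* `isOpen_image_of_bijective_mfderiv` — its image of the open set is open;
* **`contMDiffOn_invFunOn_of_bijective_mfderiv`** — if moreover it is injective on the open set
  `s`, the inverse `Function.invFunOn f s` is `C^∞` on `f '' s` (near `f x` it is the local
  inverse), with `invFunOn_mem`, `apply_invFunOn`, `invFunOn_apply` (the inverse identities) and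
  `mfderiv_invFunOn_comp` / `mfderiv_comp_invFunOn` (the differentials are mutually inverse).

Everything here is proved; no definitions besides the bookkeeping equivalence; no facts.

## References

* J. M. Lee, *Introduction to Smooth Manifolds*, 2nd ed., GTM 218 (2013), Thm. 4.5, Prop. 4.8.
  [LeeSmoothManifolds2013]
-/

noncomputable section

open Set Filter Function Manifold
open scoped Manifold ContDiff Topology

namespace Literature.Geometry.Manifold

variable {E : Type*} [NormedAddCommGroup E] [NormedSpace ℝ E] [FiniteDimensional ℝ E]
  {E' : Type*} [NormedAddCommGroup E'] [NormedSpace ℝ E']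
  {H : Type*} [TopologicalSpace H] {I : ModelWithCorners ℝ E H} [I.Boundaryless]
  {H' : Type*} [TopologicalSpace H'] {J : ModelWithCorners ℝ E' H'} [J.Boundaryless]
  {M : Type*} [TopologicalSpace M] [ChartedSpace H M] [IsManifold I ∞ M]
  {N : Type*} [TopologicalSpace N] [ChartedSpace H' N] [IsManifold J ∞ N]

/-- A bijective continuous linear map out of a finite-dimensional normed space, as a continuous
linear equivalence (`LinearEquiv.ofBijective`; finite dimension of the target is transported,
so the inverse is automatically continuous). [folklore] -/
def continuousLinearEquivOfBijective (L : E →L[ℝ] E') (hL : Bijective L) : E ≃L[ℝ] E' :=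
  haveI : FiniteDimensional ℝ E' := Module.Finite.of_surjective L.toLinearMap hL.2
  LinearEquiv.toContinuousLinearEquiv (LinearEquiv.ofBijective L.toLinearMap hL)

/-- The equivalence has the given map as underlying continuous linear map. [folklore] -/
@[simp] theorem coe_continuousLinearEquivOfBijective (L : E →L[ℝ] E') (hL : Bijective L) :
    (continuousLinearEquivOfBijective L hL : E →L[ℝ] E') = L := by
  ext v
  rfl

/-- **A `C^∞` map on an open set with bijective differential at a point is a local
diffeomorphism there** (inverse function theorem, Lee 2013, Thm. 4.5).
[cite: LeeSmoothManifolds2013, Thm. 4.5] -/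
theorem isLocalDiffeomorphAt_of_bijective_mfderiv {f : M → N} {s : Set M} (hs : IsOpen s) {x : M}
    (hx : x ∈ s) (hf : ContMDiffOn I J ∞ f s) (hbij : Bijective (mfderiv I J f x)) :
    IsLocalDiffeomorphAt I J ∞ f x :=
  isLocalDiffeomorphAt_of_mfderiv (by simp) hs hx hf
    (continuousLinearEquivOfBijective (E := E) (E' := E') (mfderiv I J f x) hbij)
    (coe_continuousLinearEquivOfBijective (E := E) (E' := E') _ hbij).symm

/-- **The image of an open set under a map with bijective differential there is open** (local
diffeomorphisms are open). [cite: LeeSmoothManifolds2013, Prop. 4.8] -/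
theorem isOpen_image_of_bijective_mfderiv {f : M → N} {s : Set M} (hs : IsOpen s)
    (hf : ContMDiffOn I J ∞ f s) (hbij : ∀ x ∈ s, Bijective (mfderiv I J f x)) :
    IsOpen (f '' s) := by
  refine isOpen_iff_mem_nhds.2 ?_
  rintro _ ⟨x, hx, rfl⟩
  have hloc := isLocalDiffeomorphAt_of_bijective_mfderiv hs hx hf (hbij x hx)
  -- `f ∘ localInverse = id` near `f x`, and `localInverse` maps near `f x` into `s`
  have h1 : ∀ᶠ y in 𝓝 (f x), f (hloc.localInverse y) = y :=
    hloc.localInverse_eventuallyEq_right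
  have hcont : ContinuousAt hloc.localInverse (f x) := hloc.localInverse_contMDiffAt.continuousAt
  have h2 : ∀ᶠ y in 𝓝 (f x), hloc.localInverse y ∈ s := by
    have hx' : hloc.localInverse (f x) ∈ s := by
      rw [hloc.localInverse_left_inv hloc.localInverse_mem_target]
      exact hx
    exact hcont.preimage_mem_nhds (hs.mem_nhds hx')
  filter_upwards [h1, h2] with y hy1 hy2
  exact ⟨_, hy2, hy1⟩

omit [TopologicalSpace M] [TopologicalSpace N] in
/-- Points of the image come from `s` through `invFunOn`. [folklore] -/
theorem invFunOn_mem {f : M → N} {s : Set M} [Nonempty M] {y : N} (hy : y ∈ f '' s) :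
    invFunOn f s y ∈ s :=
  (Function.invFunOn_pos (f := f) (s := s) (b := y) hy).1

omit [TopologicalSpace M] [TopologicalSpace N] in
/-- `f (invFunOn f s y) = y` on the image. [folklore] -/
theorem apply_invFunOn {f : M → N} {s : Set M} [Nonempty M] {y : N} (hy : y ∈ f '' s) :
    f (invFunOn f s y) = y :=
  Function.invFunOn_eq hy

omit [TopologicalSpace M] [TopologicalSpace N] in
/-- `invFunOn f s (f x) = x` for `x ∈ s` when `f` is injective on `s`. [folklore] -/
theorem invFunOn_apply {f : M → N} {s : Set M} [Nonempty M] (hinj : InjOn f s) {x : M}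
    (hx : x ∈ s) : invFunOn f s (f x) = x :=
  hinj.leftInvOn_invFunOn hx

/-- **Near an image point the inverse on `s` is the local inverse** of the inverse function
theorem. [cite: LeeSmoothManifolds2013, Thm. 4.5] -/
theorem invFunOn_eventuallyEq_localInverse {f : M → N} {s : Set M} [Nonempty M] (hs : IsOpen s)
    (hf : ContMDiffOn I J ∞ f s) (hinj : InjOn f s) {x : M} (hx : x ∈ s)
    (hbij : Bijective (mfderiv I J f x)) :
    invFunOn f s =ᶠ[𝓝 (f x)]
      (isLocalDiffeomorphAt_of_bijective_mfderiv hs hx hf hbij).localInverse := by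
  set hloc := isLocalDiffeomorphAt_of_bijective_mfderiv hs hx hf hbij
  have h1 : ∀ᶠ y in 𝓝 (f x), f (hloc.localInverse y) = y := hloc.localInverse_eventuallyEq_right
  have hcont : ContinuousAt hloc.localInverse (f x) := hloc.localInverse_contMDiffAt.continuousAt
  have h2 : ∀ᶠ y in 𝓝 (f x), hloc.localInverse y ∈ s := by
    have hx' : hloc.localInverse (f x) ∈ s := by
      rw [hloc.localInverse_left_inv hloc.localInverse_mem_target]
      exact hx
    exact hcont.preimage_mem_nhds (hs.mem_nhds hx')
  filter_upwards [h1, h2] with y hy1 hy2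
  have h := invFunOn_apply (f := f) hinj hy2
  rw [hy1] at h
  exact h

/-- **The inverse of an injective map with bijective differential on an open set is `C^∞` on the
image.** [cite: LeeSmoothManifolds2013, Thm. 4.5] -/
theorem contMDiffOn_invFunOn_of_bijective_mfderiv {f : M → N} {s : Set M} [Nonempty M]
    (hs : IsOpen s) (hf : ContMDiffOn I J ∞ f s) (hinj : InjOn f s)
    (hbij : ∀ x ∈ s, Bijective (mfderiv I J f x)) :
    ContMDiffOn J I ∞ (invFunOn f s) (f '' s) := by
  rintro _ ⟨x, hx, rfl⟩
  refine ContMDiffAt.contMDiffWithinAt ?_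
  exact ((isLocalDiffeomorphAt_of_bijective_mfderiv hs hx hf (hbij x hx)).localInverse_contMDiffAt).congr_of_eventuallyEq
    (invFunOn_eventuallyEq_localInverse hs hf hinj hx (hbij x hx))

/-- The inverse on `s` is `C^∞` at every image point. [cite: LeeSmoothManifolds2013, Thm. 4.5] -/
theorem contMDiffAt_invFunOn_of_bijective_mfderiv {f : M → N} {s : Set M} [Nonempty M]
    (hs : IsOpen s) (hf : ContMDiffOn I J ∞ f s) (hinj : InjOn f s)
    (hbij : ∀ x ∈ s, Bijective (mfderiv I J f x)) {x : M} (hx : x ∈ s) :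
    ContMDiffAt J I ∞ (invFunOn f s) (f x) :=
  (contMDiffOn_invFunOn_of_bijective_mfderiv hs hf hinj hbij).contMDiffAt
    ((isOpen_image_of_bijective_mfderiv hs hf hbij).mem_nhds ⟨x, hx, rfl⟩)

/-- **`d(invFunOn) ∘ df = id`** at points of `s`. [folklore] -/
theorem mfderiv_invFunOn_comp_mfderiv {f : M → N} {s : Set M} [Nonempty M]
    (hs : IsOpen s) (hf : ContMDiffOn I J ∞ f s) (hinj : InjOn f s)
    (hbij : ∀ x ∈ s, Bijective (mfderiv I J f x)) {x : M} (hx : x ∈ s)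
    (v : TangentSpace I x) :
    mfderiv J I (invFunOn f s) (f x) (mfderiv I J f x v) = v := by
  have hfd : MDifferentiableAt I J f x := (hf.contMDiffAt (hs.mem_nhds hx)).mdifferentiableAt (by simp)
  have hgd : MDifferentiableAt J I (invFunOn f s) (f x) :=
    (contMDiffAt_invFunOn_of_bijective_mfderiv hs hf hinj hbij hx).mdifferentiableAt (by simp)
  have hcomp := mfderiv_comp x hgd hfd
  have hid : mfderiv I I (invFunOn f s ∘ f) x = ContinuousLinearMap.id ℝ (TangentSpace I x) := by
    have hev : (invFunOn f s ∘ f) =ᶠ[𝓝 x] id :=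
      Filter.eventuallyEq_of_mem (hs.mem_nhds hx) fun z hz => invFunOn_apply hinj hz
    rw [hev.mfderiv_eq]
    exact mfderiv_id
  have h := congrArg (fun L : TangentSpace I x →L[ℝ] TangentSpace I x => L v) (hid.symm.trans hcomp)
  exact h.symm

/-- **`df ∘ d(invFunOn) = id`** at image points. [folklore] -/
theorem mfderiv_comp_mfderiv_invFunOn {f : M → N} {s : Set M} [Nonempty M]
    (hs : IsOpen s) (hf : ContMDiffOn I J ∞ f s) (hinj : InjOn f s)
    (hbij : ∀ x ∈ s, Bijective (mfderiv I J f x)) {x : M} (hx : x ∈ s)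
    (u : TangentSpace J (f x)) :
    mfderiv I J f x (mfderiv J I (invFunOn f s) (f x) u) = u := by
  obtain ⟨v, rfl⟩ := (hbij x hx).2 u
  rw [mfderiv_invFunOn_comp_mfderiv hs hf hinj hbij hx]

/-- The differential of the inverse at an image point is bijective. [folklore] -/
theorem bijective_mfderiv_invFunOn {f : M → N} {s : Set M} [Nonempty M]
    (hs : IsOpen s) (hf : ContMDiffOn I J ∞ f s) (hinj : InjOn f s)
    (hbij : ∀ x ∈ s, Bijective (mfderiv I J f x)) {x : M} (hx : x ∈ s) :
    Bijective (mfderiv J I (invFunOn f s) (f x)) := by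
  constructor
  · intro u u' h
    have h' := congrArg (mfderiv I J f x) h
    rwa [mfderiv_comp_mfderiv_invFunOn hs hf hinj hbij hx,
      mfderiv_comp_mfderiv_invFunOn hs hf hinj hbij hx] at h'
  · intro v
    exact ⟨mfderiv I J f x v, mfderiv_invFunOn_comp_mfderiv hs hf hinj hbij hx v⟩

end Literature.Geometry.Manifold

end
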